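import Summits.BirchSwinnertonDyer.Rank1Residual.Supersingular.SurjFrobeniusOrderCertificateShape
import Summits.BirchSwinnertonDyer.Rank1Residual.Additive.IntModelTamagawaCertificateLocal
import Summits.BirchSwinnertonDyer.BirchSwinnertonDyer.Theorems.Rank1ResidualIntModelReduction
import Literature.NumberTheory.EllipticCurves.Miller2011.JetchevBoundSurjective
import Literature.NumberTheory.EllipticCurves.Rank1Residual.Typed.KolyvaginCertificate
import HarnessLib

/-!
# BSD rank-≤1, LITERAL row D5 `JET@p∣N` (cell `bsd-jet`, T1 road CJ — contingency kit v3): the per-class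
# INDEX ≤ TAMAGAWA records through Miller 2011 Thm. 5.4 in its KOLYVAGIN (Thm. 4.4) case — `ρ̄_{E,p}` SURJECTIVE
# certified IN THE KERNEL, NO `p ∥ N` / `p ∤ d_K` / non-CM clause — so that EVERY surjective JET cell, the
# 97 646 additive-at-`p` ones included, has a by-name record shape

HONEST FRAMING (programme `BSD-LIT2PART-PROGRAMME-v1.md` §HONESTY, verbatim): «no tranche here proves
BSD; ARM L moves the LITERAL column of an r ≤ 1 census into the kernel-proved-modulo-named-print
column; ARM P changes what «named print» is worth. The residue (4.31 %) and every SUMMIT-BEARING rung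
(S0–S3) stay theorem-bound and are staffed by the 22 routes, not by this programme.» This file is a
TOOL: theorems only (no definition, no named fact, no `sorry`); PER PAIR; nothing is booked here;
nothing about any particular curve is asserted. Cell `bsd-jet` (run/shared/lean/pub/bsd-jet/), seat
`bsd-jet-ty` (typer), gen 2; road CJ is NOT run per `HOME/JET-PLAN.md` §1 (its rows stay FLAGGED
`JET@p∣N` until road R yields a class-free word at `p ∣ N`) — this kit exists so that such a word
re-derives the rows by a one-token swap, as this seat's gen-0 kit `JET/IndexTamagawaRecordsKit.lean`.

WHAT THIS FILE IS. Gen 0's kit (`JET.bsdp_of_jetIndexRow_tam`) goes through Miller 2011 Thm. 5.4 in its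
CHA case (`Miller2011.thm54_cha_…`, FLAG `Miller11-Thm54-Cha-case`: `p ∤ d_K`, `p² ∤ N`, `E[p]`
irreducible, non-CM) and therefore reaches only the `p ∥ N` rows. Seat `bsd-jet-lit-ty` g2 typed the
theorem's OTHER printed case (p460617, `Literature/…/Miller2011/JetchevBoundSurjective.lean`):
`Miller2011.thm54_surj_padicValNat_shaOrder_add_tamagawa_le` = Thm. 5.4 under the hypotheses of Thm. 4.4
AS PRINTED — `p` odd, `ρ̄_{E,p}` SURJECTIVE, `r_an ≤ 1`, `K` Heegner for `N`, `y_K` of infinite order ⇒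
`ord_p #Ш(E/ℚ) + 2·ord_p c_q ≤ 2·ord_p [E(K):ℤP]` for every `q ∣ N`; NO clause on `N`, NO clause on
`d_K` [arXiv:1010.2431 p. 11 L42–50 (Thm. 5.4), p. 9 L38–45 (Thm. 4.4); the author's own use at
additive `p ∣ N`, p. 15 L3–5]. At `p ∣ N` its use carries the register's reading flag `JET@p∣N`
(Jetchev 2008 prints Hypothesis (∗): `p ∤ N`) — recorded in the fact's docstring; what that flag is
worth is the referee's word, not this file's. This file gives
  * §1 the CLASS-FREE consumer `bsdp_of_millerSurj_of_index_le_tamagawa`: `BSD(E,p)` from the fact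
    (`hMS`), GZK (`hGZK`: `Ш(E/ℚ)` finite at `r_an ≤ 1`), a Heegner datum, ONE `q ∣ N` with
    `ord_p [E(K):ℤP] ≤ ord_p c_q`, `Surj W p`, `#Ш_an` a `p`-unit — the sibling of the X9 prover's
    `Rank1Residual.bsdp_of_millerJetchev_of_index_le_tamagawa` with `hirr ↦ hρ` and `hcm`/`hpD`/`hpN`
    DROPPED (two lines: `Miller2011.padicValNat_shaOrder_eq_zero_of_index_le_tamagawa_of_surj`, then
    `Typed.noPTorsion_of_padicValNat_shaOrder_eq_zero` / `Typed.bsdp_of_shaAn_unit_of_noPTorsion`);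
  * §2 the LITERAL-MODEL front ends with surjectivity and the Tamagawa half IN THE KERNEL:
    `bsdp_of_jetIndexRow_surj_min` (`p ≥ 5`: THREE Serre Prop-19 witnesses, prover B's
    `Supersingular.surj_of_ainvs_of_serreWitnesses`) and `bsdp_of_jetIndexRow_surj3_min` (`p = 3`, three
    quarters of the JET population: TWO Frobenius witnesses — one with irreducible characteristic
    polynomial mod `3`, one transvection of order `3` —, prover B's
    `Supersingular.surj_three_of_ainvs_of_irr_of_order`); in both, `c_q(W/ℚ_q) = c` from ONE `decide`-able
    `TamLocal` certificate (n1011-p03's bridge `Additive.IntModelTam.localTamagawaNumber_padic_eq_of_intModel_of_tamLocal`)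
    and `w ≤ ord_p c` — or, at an ADDITIVE carrier of type `IV`/`IV*` (`c_q = 3`, `p = 3`), from an exact stage-2
    certificate `TamX` (`bsdp_of_jetIndexRow_surj3_tamX_min`, bridge `…_of_intModel_of_tamX`) —, global minimality supplied (`hmin`: e.g. the factored five-pattern Kraus criterion
    `Supersingular.isGloballyMinimal_of_krausCriterion₃_factored`), so the DISPLAYED certificate is the pure
    index line `hv : ord_p [E(K):ℤP] ≤ w` (two index engines; never a kernel computation) next to the
    Heegner datum, `hr`, `hs`/`hvs`, `hGZK` and the ONE flagged binder `hMS`.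

References: R. L. Miller, LMS J. Comput. Math. 14 (2011) Thm. 4.4, Thm. 5.4, Def. 1.1 [Miller2011LMS];
D. Jetchev, Compos. Math. 144 (2008) Hypothesis (∗), Thm. 1.1 [Jetchev2008]; J.-P. Serre, Invent. Math. 15
(1972) §2.4 Prop. 15, §2.8 Prop. 19, §5.2 (iii) [Serre1972]; J. H. Silverman, *AEC* (2009) VII.1 Rem. 1.1,
VII.3.1 (b) [SilvermanAEC2009]; *ATAEC* (1994) IV.9.4 [SilvermanATAEC1994]; A. Kraus, Acta Arith. 54 (1989)
[Kraus1989].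
-/

set_option autoImplicit false

noncomputable section

open scoped Classical

open WeierstrassCurve Literature.NumberTheory.EllipticCurves
  Literature.NumberTheory.EllipticCurves.Rank1Residual
  Literature.NumberTheory.EllipticCurves.Rank1Residual.Typed
  Literature.NumberTheory.EllipticCurves.Rank1Residual.X11RankOneCertificates
  Literature.NumberTheory.EllipticCurves.Miller2011
  Summit.BirchSwinnertonDyer.BirchSwinnertonDyer.Rank1Residual
  Summit.BirchSwinnertonDyer.BirchSwinnertonDyer.Rank1Residual.IntModel
  Summit.BirchSwinnertonDyer.BirchSwinnertonDyer.Rank2Observatory.Tam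

namespace Summit.BirchSwinnertonDyer.Rank1Residual.JET

/-! ## §1 The class-free consumer: Miller Thm. 5.4 (Kolyvagin case) at the certificate line -/

/-- **`BSD(E,p)` from the INDEX ≤ TAMAGAWA certificate through Miller 2011 Thm. 5.4 in its Thm-4.4
(Kolyvagin, `ρ̄_{E,p}` SURJECTIVE) case.** For `E/ℚ` of analytic rank `≤ 1`, an odd prime `p` with
`ρ̄_{E,p}` onto, an imaginary quadratic `K` with the Heegner hypothesis for the level `N`, a Heegner point
`P = y_K` of infinite order, ONE prime `q ∣ N` with `ord_p [E(K):ℤP] ≤ ord_p c_q(E)` and `#Ш_an = s`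
with `ord_p s = 0`: the fact `hMS` gives `ord_p #Ш(E/ℚ) = 0`, `Ш(E/ℚ)` is finite (GZK, `hGZK`), so
`Ш(E/ℚ)[p] = 0` and Miller's `BSD(E,p)` follows (`Typed.bsdp_of_shaAn_unit_of_noPTorsion`). No clause on
`N`, `d_K` or CM (at `p ∣ N` the use of `hMS` carries the register flag `JET@p∣N`). Per pair; not a class
theorem. [cite: Miller2011LMS, Thm. 5.4 (arXiv:1010.2431 p. 11), Thm. 4.4 (p. 9) and Def. 1.1] -/
theorem bsdp_of_millerSurj_of_index_le_tamagawa
    (hMS : thm54_surj_padicValNat_shaOrder_add_tamagawa_le)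
    (hGZK : rank_eq_analyticRank_of_analyticRank_le_one)
    (W : WeierstrassCurve ℚ) [W.IsElliptic] [W.IsGloballyMinimal] (p : ℕ) [Fact p.Prime]
    {N : ℕ} [NeZero N] {K : Type} [Field K] [NumberField K] (hK : IsImaginaryQuadratic K)
    (hH : SatisfiesHeegnerHypothesis N K) {P : (W.baseChange K).toAffine.Point}
    (hP : IsHeegnerPoint N W K P) (hnt : ¬ IsOfFinAddOrder P)
    (q : ℕ) [Fact q.Prime] (hqN : q ∣ N) (hp2 : p ≠ 2) (hρ : Surj W p)
    (hI : padicValNat p (AddSubgroup.zmultiples P).index ≤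
      padicValNat p ((W.baseChange ℚ_[q]).localTamagawaNumber ℤ_[q]))
    (hr : W.analyticRank ≤ 1) {s : ℚ} (hs : shaAn W = (s : ℂ)) (hv : padicValRat p s = 0) :
    BSDp W p :=
  Typed.bsdp_of_shaAn_unit_of_noPTorsion W p hGZK hr hs hv
    (Typed.noPTorsion_of_padicValNat_shaOrder_eq_zero W p (hGZK W hr).2
      (padicValNat_shaOrder_eq_zero_of_index_le_tamagawa_of_surj hMS W hK hH hP hnt p q hqN hp2 hρ hr hI))

/-! ## §2 Literal-model front ends: surjectivity and the Tamagawa half in the kernel -/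

/-- **`BSD(E,p)` at an odd prime `p ≥ 5` (ANY reduction at `p`) for a literal integer model from the two-engine
HEEGNER-INDEX line `ord_p [E(K):ℤy_K] ≤ w`, through Miller Thm. 5.4 (Kolyvagin case), with `ρ̄_{E,p}` ONTO and the
Tamagawa exponent `w ≤ ord_p c_q(E)` CHECKED IN THE KERNEL.** Inputs: (kernel) `hmin` global minimality of the
literal model; THREE Serre Prop-19 witnesses (odd good `ℓᵢ ≠ p`, schema counts `countPoints [a] ℓᵢ = nᵢ`,
`aᵢ = ℓᵢ + 1 − nᵢ`; (i) `a₁² − 4ℓ₁ = r² ≠ 0`, `a₁ ≠ 0`; (ii) `(a₂² − 4ℓ₂)^{(p−1)/2} = −1`, `a₂ ≠ 0`;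
(iii) `a₃² = uℓ₃`, `u ∉ {0,1,2,4}`, `u² − 3u + 1 ≠ 0`, in `ZMod p`); ONE stage-1 Tamagawa certificate
`T : TamLocal` at `q = T.p` with singleton value set `[c]` and `w ≤ ord_p c`; (binders, displayed) `hMS`
(Miller Thm. 5.4 Kolyvagin case; FLAG `JET@p∣N` when `p ∣ N`), `hGZK`, the Heegner datum (`K`, Heegner
hypothesis for `N`, `P = y_K` of infinite order), `q ∣ N`, the INDEX LINE `hv : ord_p [E(K):ℤP] ≤ w`,
`r_an ≤ 1`, `#Ш_an = s` with `ord_p s = 0`. Per pair; no class statement; nothing about any particular curve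
is asserted. [cite: Miller2011LMS, Thm. 5.4 (arXiv:1010.2431 p. 11) and Def. 1.1]
[cite: Serre1972, §2.8 Prop. 19 and §5.2 (iii)] [cite: SilvermanATAEC1994, IV.9.4 and Cor. IV.9.2(d)] -/
theorem bsdp_of_jetIndexRow_surj_min (p : ℕ) (hp : p.Prime) (hp5 : 5 ≤ p) (a1 a2 a3 a4 a6 : ℤ)
    (hmin : (⟨a1, a2, a3, a4, a6⟩ : WeierstrassCurve ℚ).IsGloballyMinimal)
    (ℓ₁ ℓ₂ ℓ₃ : ℕ) (hℓ₁ : ℓ₁.Prime) (hℓ₂ : ℓ₂.Prime) (hℓ₃ : ℓ₃.Prime)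
    (h2₁ : ℓ₁ ≠ 2) (h2₂ : ℓ₂ ≠ 2) (h2₃ : ℓ₃ ≠ 2) (hne₁ : ℓ₁ ≠ p) (hne₂ : ℓ₂ ≠ p) (hne₃ : ℓ₃ ≠ p)
    (hΔ₁ : ¬ (ℓ₁ : ℤ) ∣ discOf [a1, a2, a3, a4, a6]) (hΔ₂ : ¬ (ℓ₂ : ℤ) ∣ discOf [a1, a2, a3, a4, a6])
    (hΔ₃ : ¬ (ℓ₃ : ℤ) ∣ discOf [a1, a2, a3, a4, a6])
    {n₁ n₂ n₃ : ℕ} (hc₁ : countPoints [a1, a2, a3, a4, a6] ℓ₁ = n₁)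
    (hc₂ : countPoints [a1, a2, a3, a4, a6] ℓ₂ = n₂) (hc₃ : countPoints [a1, a2, a3, a4, a6] ℓ₃ = n₃)
    (r u : ZMod p)
    (hi : (((ℓ₁ : ℤ) + 1 - n₁ : ℤ) : ZMod p) ^ 2 - 4 * ℓ₁ = r * r ∧
      (((ℓ₁ : ℤ) + 1 - n₁ : ℤ) : ZMod p) ^ 2 - 4 * ℓ₁ ≠ 0 ∧ (((ℓ₁ : ℤ) + 1 - n₁ : ℤ) : ZMod p) ≠ 0)
    (hii : ((((ℓ₂ : ℤ) + 1 - n₂ : ℤ) : ZMod p) ^ 2 - 4 * ℓ₂) ^ (p / 2) = -1 ∧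
      (((ℓ₂ : ℤ) + 1 - n₂ : ℤ) : ZMod p) ≠ 0)
    (hiii : (((ℓ₃ : ℤ) + 1 - n₃ : ℤ) : ZMod p) ^ 2 = u * ℓ₃ ∧
      u ≠ 0 ∧ u ≠ 1 ∧ u ≠ 2 ∧ u ≠ 4 ∧ u ^ 2 - 3 * u + 1 ≠ 0)
    (q : ℕ) (T : TamLocal) (hTq : T.p = q) (hT : T.check ⟨a1, a2, a3, a4, a6⟩ = true)
    {c : ℕ} (hvals : T.vals = [c]) {w : ℕ} (hw : w ≤ padicValNat p c)
    (hMS : thm54_surj_padicValNat_shaOrder_add_tamagawa_le)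
    (hGZK : rank_eq_analyticRank_of_analyticRank_le_one)
    (W : WeierstrassCurve ℚ) (hW : W = ⟨a1, a2, a3, a4, a6⟩)
    {N : ℕ} [NeZero N] {K : Type} [Field K] [NumberField K] (hK : IsImaginaryQuadratic K)
    (hH : SatisfiesHeegnerHypothesis N K) {P : (W.baseChange K).toAffine.Point}
    (hP : IsHeegnerPoint N W K P) (hnt : ¬ IsOfFinAddOrder P) (hqN : q ∣ N)
    (hv : padicValNat p (AddSubgroup.zmultiples P).index ≤ w)
    (hr : W.analyticRank ≤ 1) {s : ℚ} (hs : shaAn W = (s : ℂ)) (hvs : padicValRat p s = 0) :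
    BSDp W p := by
  subst hW
  have h0 : discOf [a1, a2, a3, a4, a6] ≠ 0 := fun h ↦ hΔ₁ (by rw [h]; exact dvd_zero _)
  haveI hE : (⟨a1, a2, a3, a4, a6⟩ : WeierstrassCurve ℚ).IsElliptic :=
    X11b.isElliptic_of_discOf_ne_zero a1 a2 a3 a4 a6 h0
  haveI := hmin
  haveI : Fact (Nat.Prime p) := ⟨hp⟩
  haveI : Fact (Nat.Prime q) := ⟨hTq ▸ (TamLocal.check_common hT).1⟩
  have hp2 : p ≠ 2 := by omega
  have hI0 : integralModelInt (⟨a1, a2, a3, a4, a6⟩ : WeierstrassCurve ℚ) = ⟨a1, a2, a3, a4, a6⟩ :=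
    integralModelInt_eq_of_map_eq _ (map_mk_int a1 a2 a3 a4 a6)
  -- `ρ̄_{E,p}` surjective from the three Serre witnesses (Serre 1972 Prop. 19)
  have hρ : Surj (⟨a1, a2, a3, a4, a6⟩ : WeierstrassCurve ℚ) p :=
    Supersingular.surj_of_ainvs_of_serreWitnesses a1 a2 a3 a4 a6 p hp5 hmin ℓ₁ ℓ₂ ℓ₃ hℓ₁ hℓ₂ hℓ₃
      h2₁ h2₂ h2₃ hne₁ hne₂ hne₃ hΔ₁ hΔ₂ hΔ₃ hc₁ hc₂ hc₃ r u hi hii hiii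
  -- the Tamagawa half in the kernel: `c_q(W/ℚ_q) = c`
  have hcq : ((⟨a1, a2, a3, a4, a6⟩ : WeierstrassCurve ℚ).baseChange ℚ_[q]).localTamagawaNumber ℤ_[q] = c :=
    Additive.IntModelTam.localTamagawaNumber_padic_eq_of_intModel_of_tamLocal hI0 q hTq hT hvals
  have hI : padicValNat p (AddSubgroup.zmultiples P).index ≤
      padicValNat p (((⟨a1, a2, a3, a4, a6⟩ : WeierstrassCurve ℚ).baseChange ℚ_[q]).localTamagawaNumber
        ℤ_[q]) := by
    rw [hcq]; exact hv.trans hw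
  exact bsdp_of_millerSurj_of_index_le_tamagawa hMS hGZK _ p hK hH hP hnt q hqN hp2 hρ hI hr hs hvs

/-- **`BSD(E,3)` (ANY reduction at `3`) for a literal integer model from the two-engine HEEGNER-INDEX line
`ord₃ [E(K):ℤy_K] ≤ w`, through Miller Thm. 5.4 (Kolyvagin case), with `ρ̄_{E,3}` ONTO and the Tamagawa exponent
`w ≤ ord₃ c_q(E)` CHECKED IN THE KERNEL.** Inputs: (kernel) `hmin`; TWO Frobenius witnesses at odd good primes
`ℓ₁, ℓ₂ ≠ 3` (schema counts `countPoints [a] ℓᵢ = nᵢ`): (i) `X² − a₁X + ℓ₁` irreducible mod `3` (no Borel);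
(ii) `ℓ₂ ≡ 1`, `a₂ ≡ 2 (mod 3)`, `9 ∤ n₂` (a transvection of order `3`; Serre Prop. 15 + `det` onto) — prover B's
`Supersingular.surj_three_of_ainvs_of_irr_of_order`; ONE `TamLocal` certificate at `q` with value set `[c]` and
`w ≤ ord₃ c`; (binders, displayed) `hMS` (FLAG `JET@p∣N` when `3 ∣ N`), `hGZK`, the Heegner datum, `q ∣ N`, the
INDEX LINE `hv : ord₃ [E(K):ℤP] ≤ w`, `r_an ≤ 1`, `#Ш_an = s` with `ord₃ s = 0`. Per pair; no class statement;
nothing about any particular curve is asserted. [cite: Miller2011LMS, Thm. 5.4 (arXiv:1010.2431 p. 11) and Def. 1.1]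
[cite: Serre1972, §2.4 Prop. 15 and §5.2 (iii)] [cite: SilvermanAEC2009, VII.3.1(b)] [cite: SilvermanATAEC1994, IV.9.4] -/
theorem bsdp_of_jetIndexRow_surj3_min (a1 a2 a3 a4 a6 : ℤ)
    (hmin : (⟨a1, a2, a3, a4, a6⟩ : WeierstrassCurve ℚ).IsGloballyMinimal)
    (ℓ₁ ℓ₂ : ℕ) (hℓ₁ : ℓ₁.Prime) (hℓ₂ : ℓ₂.Prime) (h2₁ : ℓ₁ ≠ 2) (h2₂ : ℓ₂ ≠ 2)
    (h3₁ : ℓ₁ ≠ 3) (h3₂ : ℓ₂ ≠ 3)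
    (hΔ₁ : ¬ (ℓ₁ : ℤ) ∣ discOf [a1, a2, a3, a4, a6]) (hΔ₂ : ¬ (ℓ₂ : ℤ) ∣ discOf [a1, a2, a3, a4, a6])
    {n₁ n₂ : ℕ} (hc₁ : countPoints [a1, a2, a3, a4, a6] ℓ₁ = n₁)
    (hc₂ : countPoints [a1, a2, a3, a4, a6] ℓ₂ = n₂)
    (hirr : ∀ t : ZMod 3, t ^ 2 - (((ℓ₁ : ℤ) + 1 - n₁ : ℤ) : ZMod 3) * t + ℓ₁ ≠ 0)
    (hdet₂ : (ℓ₂ : ZMod 3) = 1) (htr₂ : (((ℓ₂ : ℤ) + 1 - n₂ : ℤ) : ZMod 3) = 2) (hsq : ¬ 9 ∣ n₂)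
    (q : ℕ) (T : TamLocal) (hTq : T.p = q) (hT : T.check ⟨a1, a2, a3, a4, a6⟩ = true)
    {c : ℕ} (hvals : T.vals = [c]) {w : ℕ} (hw : w ≤ padicValNat 3 c)
    (hMS : thm54_surj_padicValNat_shaOrder_add_tamagawa_le)
    (hGZK : rank_eq_analyticRank_of_analyticRank_le_one)
    (W : WeierstrassCurve ℚ) (hW : W = ⟨a1, a2, a3, a4, a6⟩)
    {N : ℕ} [NeZero N] {K : Type} [Field K] [NumberField K] (hK : IsImaginaryQuadratic K)
    (hH : SatisfiesHeegnerHypothesis N K) {P : (W.baseChange K).toAffine.Point}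
    (hP : IsHeegnerPoint N W K P) (hnt : ¬ IsOfFinAddOrder P) (hqN : q ∣ N)
    (hv : padicValNat 3 (AddSubgroup.zmultiples P).index ≤ w)
    (hr : W.analyticRank ≤ 1) {s : ℚ} (hs : shaAn W = (s : ℂ)) (hvs : padicValRat 3 s = 0) :
    BSDp W 3 := by
  subst hW
  have h0 : discOf [a1, a2, a3, a4, a6] ≠ 0 := fun h ↦ hΔ₁ (by rw [h]; exact dvd_zero _)
  haveI hE : (⟨a1, a2, a3, a4, a6⟩ : WeierstrassCurve ℚ).IsElliptic :=
    X11b.isElliptic_of_discOf_ne_zero a1 a2 a3 a4 a6 h0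
  haveI := hmin
  haveI : Fact (Nat.Prime 3) := ⟨by norm_num⟩
  haveI : Fact (Nat.Prime q) := ⟨hTq ▸ (TamLocal.check_common hT).1⟩
  have hI0 : integralModelInt (⟨a1, a2, a3, a4, a6⟩ : WeierstrassCurve ℚ) = ⟨a1, a2, a3, a4, a6⟩ :=
    integralModelInt_eq_of_map_eq _ (map_mk_int a1 a2 a3 a4 a6)
  -- `ρ̄_{E,3}` surjective from the two Frobenius witnesses (irreducible + order 3)
  have hρ : Surj (⟨a1, a2, a3, a4, a6⟩ : WeierstrassCurve ℚ) 3 :=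
    Supersingular.surj_three_of_ainvs_of_irr_of_order a1 a2 a3 a4 a6 hmin ℓ₁ ℓ₂ hℓ₁ hℓ₂ h2₁ h2₂ h3₁ h3₂
      hΔ₁ hΔ₂ hc₁ hc₂ hirr hdet₂ htr₂ hsq
  -- the Tamagawa half in the kernel: `c_q(W/ℚ_q) = c`
  have hcq : ((⟨a1, a2, a3, a4, a6⟩ : WeierstrassCurve ℚ).baseChange ℚ_[q]).localTamagawaNumber ℤ_[q] = c :=
    Additive.IntModelTam.localTamagawaNumber_padic_eq_of_intModel_of_tamLocal hI0 q hTq hT hvals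
  have hI : padicValNat 3 (AddSubgroup.zmultiples P).index ≤
      padicValNat 3 (((⟨a1, a2, a3, a4, a6⟩ : WeierstrassCurve ℚ).baseChange ℚ_[q]).localTamagawaNumber
        ℤ_[q]) := by
    rw [hcq]; exact hv.trans hw
  exact bsdp_of_millerSurj_of_index_le_tamagawa hMS hGZK _ 3 hK hH hP hnt q hqN (by decide) hρ hI hr hs hvs

/-- **`BSD(E,3)` for a literal integer model from the HEEGNER-INDEX line `ord₃ [E(K):ℤy_K] ≤ w` through Miller Thm. 5.4
(Kolyvagin case), `ρ̄_{E,3}` ONTO in the kernel, the stringent prime `q` of ADDITIVE type `IV` / `IV*` (`c_q = 3`):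
the Tamagawa half from an EXACT stage-2 certificate `F : TamX`** (Tate's algorithm Steps 5 / 8: `c_q = 3` by a root
witness of the residual quadratic; n1011-p03's bridge `Additive.IntModelTam.localTamagawaNumber_padic_eq_of_intModel_of_tamX`),
`w ≤ ord₃ F.c`. The typical bucket-B row at `p = 3` (`q = 3` of type `IV`/`IV*`) and the bucket-A rows whose carrier
is an additive `IV`/`IV*` prime. Other inputs and displayed binders as in `bsdp_of_jetIndexRow_surj3_min`. Per pair; no
class statement; nothing about any particular curve is asserted. [cite: Miller2011LMS, Thm. 5.4 (arXiv:1010.2431 p. 11) and Def. 1.1]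
[cite: Serre1972, §2.4 Prop. 15 and §5.2 (iii)] [cite: SilvermanATAEC1994, IV.9.4 Steps 5 and 8] -/
theorem bsdp_of_jetIndexRow_surj3_tamX_min (a1 a2 a3 a4 a6 : ℤ)
    (hmin : (⟨a1, a2, a3, a4, a6⟩ : WeierstrassCurve ℚ).IsGloballyMinimal)
    (ℓ₁ ℓ₂ : ℕ) (hℓ₁ : ℓ₁.Prime) (hℓ₂ : ℓ₂.Prime) (h2₁ : ℓ₁ ≠ 2) (h2₂ : ℓ₂ ≠ 2)
    (h3₁ : ℓ₁ ≠ 3) (h3₂ : ℓ₂ ≠ 3)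
    (hΔ₁ : ¬ (ℓ₁ : ℤ) ∣ discOf [a1, a2, a3, a4, a6]) (hΔ₂ : ¬ (ℓ₂ : ℤ) ∣ discOf [a1, a2, a3, a4, a6])
    {n₁ n₂ : ℕ} (hc₁ : countPoints [a1, a2, a3, a4, a6] ℓ₁ = n₁)
    (hc₂ : countPoints [a1, a2, a3, a4, a6] ℓ₂ = n₂)
    (hirr : ∀ t : ZMod 3, t ^ 2 - (((ℓ₁ : ℤ) + 1 - n₁ : ℤ) : ZMod 3) * t + ℓ₁ ≠ 0)
    (hdet₂ : (ℓ₂ : ZMod 3) = 1) (htr₂ : (((ℓ₂ : ℤ) + 1 - n₂ : ℤ) : ZMod 3) = 2) (hsq : ¬ 9 ∣ n₂)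
    (q : ℕ) (hq : q.Prime) (F : TamX) (hFq : F.p = q) (hF : F.check ⟨a1, a2, a3, a4, a6⟩ = true)
    {w : ℕ} (hw : w ≤ padicValNat 3 F.c)
    (hMS : thm54_surj_padicValNat_shaOrder_add_tamagawa_le)
    (hGZK : rank_eq_analyticRank_of_analyticRank_le_one)
    (W : WeierstrassCurve ℚ) (hW : W = ⟨a1, a2, a3, a4, a6⟩)
    {N : ℕ} [NeZero N] {K : Type} [Field K] [NumberField K] (hK : IsImaginaryQuadratic K)
    (hH : SatisfiesHeegnerHypothesis N K) {P : (W.baseChange K).toAffine.Point}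
    (hP : IsHeegnerPoint N W K P) (hnt : ¬ IsOfFinAddOrder P) (hqN : q ∣ N)
    (hv : padicValNat 3 (AddSubgroup.zmultiples P).index ≤ w)
    (hr : W.analyticRank ≤ 1) {s : ℚ} (hs : shaAn W = (s : ℂ)) (hvs : padicValRat 3 s = 0) :
    BSDp W 3 := by
  subst hW
  have h0 : discOf [a1, a2, a3, a4, a6] ≠ 0 := fun h ↦ hΔ₁ (by rw [h]; exact dvd_zero _)
  haveI hE : (⟨a1, a2, a3, a4, a6⟩ : WeierstrassCurve ℚ).IsElliptic :=
    X11b.isElliptic_of_discOf_ne_zero a1 a2 a3 a4 a6 h0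
  haveI := hmin
  haveI : Fact (Nat.Prime 3) := ⟨by norm_num⟩
  haveI : Fact (Nat.Prime q) := ⟨hq⟩
  have hI0 : integralModelInt (⟨a1, a2, a3, a4, a6⟩ : WeierstrassCurve ℚ) = ⟨a1, a2, a3, a4, a6⟩ :=
    integralModelInt_eq_of_map_eq _ (map_mk_int a1 a2 a3 a4 a6)
  have hρ : Surj (⟨a1, a2, a3, a4, a6⟩ : WeierstrassCurve ℚ) 3 :=
    Supersingular.surj_three_of_ainvs_of_irr_of_order a1 a2 a3 a4 a6 hmin ℓ₁ ℓ₂ hℓ₁ hℓ₂ h2₁ h2₂ h3₁ h3₂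
      hΔ₁ hΔ₂ hc₁ hc₂ hirr hdet₂ htr₂ hsq
  -- the Tamagawa half in the kernel: `c_q(W/ℚ_q) = F.c` (exact IV / IV* certificate)
  have hcq : ((⟨a1, a2, a3, a4, a6⟩ : WeierstrassCurve ℚ).baseChange ℚ_[q]).localTamagawaNumber ℤ_[q] = F.c :=
    Additive.IntModelTam.localTamagawaNumber_padic_eq_of_intModel_of_tamX hI0 q hFq hF
  have hI : padicValNat 3 (AddSubgroup.zmultiples P).index ≤
      padicValNat 3 (((⟨a1, a2, a3, a4, a6⟩ : WeierstrassCurve ℚ).baseChange ℚ_[q]).localTamagawaNumber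
        ℤ_[q]) := by
    rw [hcq]; exact hv.trans hw
  exact bsdp_of_millerSurj_of_index_le_tamagawa hMS hGZK _ 3 hK hH hP hnt q hqN (by decide) hρ hI hr hs hvs

end Summit.BirchSwinnertonDyer.Rank1Residual.JET

end
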